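import Summits.QuantumFields.BalabanUV.Beta.SymCorrectorSlot
import Literature.MathematicalPhysics.QuantumFieldTheory.Balaban1983to89.Beta.SecondOrderResponse

/-!
# `BalabanUV.Beta.SymCorrectorPair` — binder row D1, road «BF-x» junction (J1), the `Δ_n` Ward program (an2 R-D1-g43-3 (2)), brick TT4 = (W-pair) of the OWNER's
# `HOME/b2b-balaban-beta-d1-p2/J1-DEFECT-WORDS.md` v0.1 §3: **THE PAIR SLOT TRANSPORTS ON BOTH INDICES** —
#   **`vertex2OfK (Ψ̂_S ∘ K ∘ Ψ̂_Sᵀ) n S₂ μ y ν y′ = vertex2OfK K n (fun α x => slotPsiS r n (slotPsiS r n S₂ α x)) μ y ν y′`**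
# for every spread `K`, every local fine bi-stencil family `S₂` (`BalabanCompositeJets.LocStencil₂`, `0 < δ`) and every in-block root offset `r ∈ box (d+1) n`:
# the second-order chain-rule vertex through the conjugated kernel is the vertex through `K` of the pair family with BOTH bond slots transported by `Ψ_Sᵀ`
# (the outer `slotPsiS` acts on `S₂` as a family in its first bond valued in stencil families, the inner on each slice) — «two insertions per slot pair, then the
# expansion terminates» of the words file, as ONE identity; no infinite sum in either slot direction.

HOW ([folklore]).  `vertex2OfK K n S₂ μ y ν y′ = vertexOfK K n (κ u ↦ vertexOfK K n (S₂ κ u) ν y′) μ y` (`SecondOrderResponse.vertex2OfK`, by `rfl`).  OUTER slot: TT3b's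
entrywise adjunction `vertexOfK_conj_psiKS_apply` with centre `x` — the family `κ u ↦ vertexOfK K′ n (S₂ κ u) ν y′ x z a b` is localised at `x` by the Literature's
`SecondOrderResponse.biLoc_vertexOfK_slice` (§2).  COMMUTATION (§1): `slotPsiS r n (κ u ↦ vertexOfK K n (F κ u) ν y′) α x = vertexOfK K n (slotPsiS r n F α x) ν y′` for a
decaying `K` and bounded slices (the face sum is finite; `Summable.tsum_add ∕ tsum_finsetSum ∕ tsum_mul_left`).  INNER slot: `vertexOfK_conj_psiKS_apply` again, centre `x`, on the
slice `slotPsiS r n S₂ α x`, localised at `x` with the face constant (§2 `abs_slotPsiS_slice_le_exp`).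

HONEST FRAMING (cell contract, verbatim): «discharging `BetaPertH` makes Bałaban's UV stability UNCONDITIONAL — a real constructive-QFT result; it
is NOT the continuum limit and NOT the Clay problem.»  HONEST DEPENDENCY (verbatim): «continuum YM on T⁴ ⇐ BetaPertH ∧ nine spine estimates (0/9
proved); BetaPertH ⇐ (D1) ∧ (D4) ∧ CAP+tail; G-an2-4 gates asym, D1 and NE2/3/4.»
ABSOLUTE RULE (cell, verbatim): «No internally-minted statement may enter as a cited fact. Every hypothesis is either kernel-proved in this package or a
verbatim quotation of a PUBLISHED theorem with page reference. The manuscript(s) under audit are NOT citable for their own disputed steps — they are the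
thing under adjudication; programme-internal (2001/route/tribunal) claims are never citable.»  NOTHING is cited; no `def`, no `Prop` fact, 0 sorry; [folklore] absolutely-convergent-sum
bookkeeping over the cell's OWN typed objects BY NAME.  It prices NO row of (J1) and says nothing about the CURRENCY in which the pair words are to be priced (OWNER F-g22-2);
discharges NOTHING of (K), of hW ∕ hR ∕ D1Tel ∕ D1Rep (0∕4), of D1 or of BetaPertH; NOT continuum, NOT Clay.

CONTENT ([folklore]; `d+1` the lattice dimension, `0 < n`, `r ∈ box (d+1) n`):
§1 `summable_colH_mul_of_bounded`, **`slotPsiS_vertexOfK_comm`**.  §2 `abs_slice_le_exp` (a `LocStencil₂` slice read at an entry is localised at its first bond),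
`abs_slice_le_exp_left` (… and at the entry's left site), `abs_slotPsiS_slice_le_exp_left` (so is the transported slice), `abs_vertexOfK_slice_le_exp_left`
(the inner vertex of a slice is localised at the entry's left site — `biLoc_vertexOfK_slice`).  §3 **`vertex2OfK_conj_psiKS`** (THE PAIR SLOT ADJUNCTION).
(The [S] socket of the doubly transported pair family is TT5 `SymCorrectorSockets.locStencil₂_slotPsiS₂`.)
Provenance: D1 formalisation swarm, unit `b2b-balaban-beta-d1-formalise-leaf-03` (gen 29), 2026-08-23; over TT3a∕TT3b and the Literature's `SecondOrderResponse` BY NAME; no file touched.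
-/

namespace Summit.QuantumFields.BalabanUV.Beta.SymCorrectorPair

open Finset
open scoped BigOperators
open Literature.MathematicalPhysics.QuantumFieldTheory
open Literature.MathematicalPhysics.QuantumFieldTheory.Balaban1983to89
open Literature.MathematicalPhysics.QuantumFieldTheory.Balaban1983to89.Beta
open B12Sec2to5 (l1 l1_nonneg)
open ExpKernelCalculus (MKer Decays BiLoc comp Zl Zl_nonneg l1_sub_triangle l1_sub_symm summable_exp_shift')
open OneStepResolventKernel (Fib wsum LocStencil)
open OneStepKernelFamily (colH vertexOfK abs_colH_le)
open BalabanCompositeJets (LocStencil₂)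
open SecondOrderResponse (vertex2OfK biLoc_vertexOfK_slice)
open AffineAveraging (Site Form1 box toSite)
open AveragingContours (blk)
open Summit.QuantumFields.BalabanUV.Beta.TameKernelCalculus (Spr trK Spr.trK decays_of_le)
open Summit.QuantumFields.BalabanUV.Beta.ChartConjugationRelative (spr_comp)
open Summit.QuantumFields.BalabanUV.Beta.KernelWardRelative (gaugeWt)
open Summit.QuantumFields.BalabanUV.Beta.SymCorrectorKernel (psiKS spr_psiKS)
open Summit.QuantumFields.BalabanUV.Beta.SymCorrectorFace (faceWt faceWtSum faceWtSum_nonneg abs_faceWt_le gaugeWt_eq bondNbhd card_bondNbhd_le l1_le_of_mem_bondNbhd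
  slotPsiS slotPsiS_apply slotPsiS_apply_kernel)
open Summit.QuantumFields.BalabanUV.Beta.SymCorrectorSlot (abs_slotPsiS_le_of_bounded vertexOfK_conj_psiKS_apply)

noncomputable section

variable {d : ℕ}

/-! ## §1 The slot transport commutes with the chain-rule vertex in the other bond -/

section Comm

variable {n : ℕ} {K : MKer (d + 1) (Fib d)} {C δ : ℝ}

/-- [folklore] A decaying packing column against a bounded scalar family is absolutely summable. -/
theorem summable_colH_mul_of_bounded (hK : Decays K C δ) (hδ : 0 < δ) (μ : Fin (d + 1)) (y : Site (d + 1)) (κ : Fin (d + 1)) {g : Site (d + 1) → ℝ} {B : ℝ}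
    (hg : ∀ u, |g u| ≤ B) : Summable fun u => colH K n μ y κ u * g u := by
  have hC : 0 ≤ C := hK.nonneg (Sum.inl 0)
  refine Summable.of_norm_bounded (((summable_exp_shift' hδ ((n : ℤ) • y)).mul_left C).mul_right B) fun u => ?_
  rw [Real.norm_eq_abs, abs_mul]
  exact mul_le_mul (abs_colH_le (N := n) hK μ y κ u) (hg u) (abs_nonneg _) (by positivity)

/-- [folklore] **THE SLOT TRANSPORT IN THE FIRST BOND COMMUTES WITH THE CHAIN-RULE VERTEX IN THE SECOND**: for a decaying `K` and a family `F` of stencil families with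
bounded entries, `slotPsiS r n (κ u ↦ vertexOfK K n (F κ u) ν y′) α x = vertexOfK K n (slotPsiS r n F α x) ν y′` (the outer `slotPsiS` reads `F` as valued in stencil families;
the face sum is finite, each packing series absolutely convergent). -/
theorem slotPsiS_vertexOfK_comm (hK : Decays K C δ) (hδ : 0 < δ) (r : Fin (d + 1) → ℕ)
    (F : Fin (d + 1) → Site (d + 1) → Fin (d + 1) → Site (d + 1) → MKer (d + 1) (Fib d)) {B : ℝ} (hB : ∀ κ u κ' u' p q a b, |F κ u κ' u' p q a b| ≤ B)
    (ν : Fin (d + 1)) (y' : Site (d + 1)) :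
    slotPsiS r n (fun κ u => vertexOfK K n (F κ u) ν y') = fun α x => vertexOfK K n (slotPsiS r n F α x) ν y' := by
  classical
  funext α x p q a b
  rw [slotPsiS_apply_kernel]
  -- both sides, entrywise
  have eL : slotPsiS r n (fun κ u => vertexOfK K n (F κ u) ν y' p q a b) α x
      = (∑ κ' : Fin (d + 1), ∑' u', colH K n ν y' κ' u' * F α x κ' u' p q a b)
        + faceWt r n α x * ∑ κ : Fin (d + 1), ∑ u ∈ bondNbhd n (blk n x) κ,
            gaugeWt n (blk n x) κ u * ∑ κ' : Fin (d + 1), ∑' u', colH K n ν y' κ' u' * F κ u κ' u' p q a b := by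
    rw [slotPsiS_apply]; simp only [smul_eq_mul]; rfl
  have eR : vertexOfK K n (slotPsiS r n F α x) ν y' p q a b
      = ∑ κ' : Fin (d + 1), ∑' u', colH K n ν y' κ' u' * ((F α x κ' u' p q a b)
          + faceWt r n α x * ∑ κ : Fin (d + 1), ∑ u ∈ bondNbhd n (blk n x) κ, gaugeWt n (blk n x) κ u * F κ u κ' u' p q a b) := by
    show (∑ κ' : Fin (d + 1), ∑' u', colH K n ν y' κ' u' * (slotPsiS r n F α x) κ' u' p q a b) = _
    refine Finset.sum_congr rfl fun κ' _ => tsum_congr fun u' => ?_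
    rw [slotPsiS_apply]
    simp only [Pi.add_apply, Pi.smul_apply, Finset.sum_apply, smul_eq_mul]
  rw [eL, eR]
  -- split the right side's series
  have hs1 : ∀ κ' : Fin (d + 1), Summable fun u' => colH K n ν y' κ' u' * F α x κ' u' p q a b := fun κ' =>
    summable_colH_mul_of_bounded hK hδ ν y' κ' fun u' => hB α x κ' u' p q a b
  have hs3 : ∀ (κ' κ : Fin (d + 1)) (u : Site (d + 1)), Summable fun u' => colH K n ν y' κ' u' * F κ u κ' u' p q a b := fun κ' κ u =>
    summable_colH_mul_of_bounded hK hδ ν y' κ' fun u' => hB κ u κ' u' p q a b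
  have hs2 : ∀ κ' : Fin (d + 1), Summable fun u' => colH K n ν y' κ' u'
      * (faceWt r n α x * ∑ κ : Fin (d + 1), ∑ u ∈ bondNbhd n (blk n x) κ, gaugeWt n (blk n x) κ u * F κ u κ' u' p q a b) := by
    intro κ'
    have e : (fun u' => colH K n ν y' κ' u' * (faceWt r n α x * ∑ κ : Fin (d + 1), ∑ u ∈ bondNbhd n (blk n x) κ, gaugeWt n (blk n x) κ u * F κ u κ' u' p q a b))
        = fun u' => ∑ κ : Fin (d + 1), ∑ u ∈ bondNbhd n (blk n x) κ, (faceWt r n α x * gaugeWt n (blk n x) κ u) * (colH K n ν y' κ' u' * F κ u κ' u' p q a b) := by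
      funext u'
      rw [Finset.mul_sum, Finset.mul_sum]
      refine Finset.sum_congr rfl fun κ _ => ?_
      rw [Finset.mul_sum, Finset.mul_sum]
      exact Finset.sum_congr rfl fun u _ => by ring
    rw [e]
    exact summable_sum fun κ _ => summable_sum fun u _ => (hs3 κ' κ u).mul_left _
  have step : ∀ κ' : Fin (d + 1), (∑' u', colH K n ν y' κ' u' * ((F α x κ' u' p q a b)
        + faceWt r n α x * ∑ κ : Fin (d + 1), ∑ u ∈ bondNbhd n (blk n x) κ, gaugeWt n (blk n x) κ u * F κ u κ' u' p q a b))
      = (∑' u', colH K n ν y' κ' u' * F α x κ' u' p q a b)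
        + faceWt r n α x * ∑ κ : Fin (d + 1), ∑ u ∈ bondNbhd n (blk n x) κ, gaugeWt n (blk n x) κ u * ∑' u', colH K n ν y' κ' u' * F κ u κ' u' p q a b := by
    intro κ'
    have e1 : (fun u' => colH K n ν y' κ' u' * ((F α x κ' u' p q a b)
        + faceWt r n α x * ∑ κ : Fin (d + 1), ∑ u ∈ bondNbhd n (blk n x) κ, gaugeWt n (blk n x) κ u * F κ u κ' u' p q a b))
        = fun u' => colH K n ν y' κ' u' * F α x κ' u' p q a b + colH K n ν y' κ' u'
          * (faceWt r n α x * ∑ κ : Fin (d + 1), ∑ u ∈ bondNbhd n (blk n x) κ, gaugeWt n (blk n x) κ u * F κ u κ' u' p q a b) := by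
      funext u'; ring
    rw [e1, (hs1 κ').tsum_add (hs2 κ')]
    congr 1
    have e2 : (fun u' => colH K n ν y' κ' u' * (faceWt r n α x * ∑ κ : Fin (d + 1), ∑ u ∈ bondNbhd n (blk n x) κ, gaugeWt n (blk n x) κ u * F κ u κ' u' p q a b))
        = fun u' => ∑ κ : Fin (d + 1), ∑ u ∈ bondNbhd n (blk n x) κ, (faceWt r n α x * gaugeWt n (blk n x) κ u) * (colH K n ν y' κ' u' * F κ u κ' u' p q a b) := by
      funext u'
      rw [Finset.mul_sum, Finset.mul_sum]
      refine Finset.sum_congr rfl fun κ _ => ?_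
      rw [Finset.mul_sum, Finset.mul_sum]
      exact Finset.sum_congr rfl fun u _ => by ring
    rw [e2, Summable.tsum_finsetSum (fun κ _ => summable_sum fun u _ => (hs3 κ' κ u).mul_left _), Finset.mul_sum]
    refine Finset.sum_congr rfl fun κ _ => ?_
    rw [Summable.tsum_finsetSum (fun u _ => (hs3 κ' κ u).mul_left _), Finset.mul_sum]
    refine Finset.sum_congr rfl fun u _ => ?_
    rw [tsum_mul_left]; ring
  rw [Finset.sum_congr rfl fun κ' _ => step κ', Finset.sum_add_distrib]
  congr 1
  rw [← Finset.mul_sum]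
  congr 1
  rw [Finset.sum_comm]
  refine Finset.sum_congr rfl fun κ _ => ?_
  rw [Finset.sum_comm]
  refine Finset.sum_congr rfl fun u _ => ?_
  rw [Finset.mul_sum]

end Comm

/-! ## §2 Slices of a fine bi-stencil family and their inner vertices are localised at the entry's left site -/

section Slices

variable {S₂ : Fin (d + 1) → Site (d + 1) → Fin (d + 1) → Site (d + 1) → MKer (d + 1) (Fib d)} {C₂ δ₂ : ℝ}

/-- [folklore] **A SLICE ENTRY IS BOUNDED BY THE BI-STENCIL CONSTANT** (`0 ≤ δ`). -/
theorem abs_slice_le (hS₂ : LocStencil₂ S₂ C₂ δ₂) (hδ₂ : 0 ≤ δ₂) (κ : Fin (d + 1)) (u : Site (d + 1)) (κ' : Fin (d + 1)) (u' p q : Site (d + 1)) (a b : Fib d) :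
    |S₂ κ u κ' u' p q a b| ≤ C₂ := by
  have hC₂ : 0 ≤ C₂ := hS₂.nonneg
  refine (hS₂ κ u κ' u' p q a b).trans ?_
  have h1 : Real.exp (-δ₂ * l1 (u' - u)) ≤ 1 := by rw [Real.exp_le_one_iff]; nlinarith [l1_nonneg (u' - u)]
  have h2 : Real.exp (-δ₂ * (l1 (p - u) + l1 (q - u))) ≤ 1 := by rw [Real.exp_le_one_iff]; nlinarith [l1_nonneg (p - u), l1_nonneg (q - u)]
  calc C₂ * Real.exp (-δ₂ * l1 (u' - u)) * Real.exp (-δ₂ * (l1 (p - u) + l1 (q - u))) ≤ C₂ * 1 * 1 :=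
        mul_le_mul (mul_le_mul_of_nonneg_left h1 hC₂) h2 (Real.exp_pos _).le (by positivity)
    _ = C₂ := by ring

/-- [folklore] **A SLICE ENTRY READ AT `(p, q)` IS LOCALISED IN ITS SECOND BOND AT THE LEFT SITE `p`**: `|S₂ κ u κ′ u′ p q a b| ≤ C₂·e^{−δ|u′ − p|₁}` (triangle through `u`). -/
theorem abs_slice_le_exp_left (hS₂ : LocStencil₂ S₂ C₂ δ₂) (hδ₂ : 0 ≤ δ₂) (κ : Fin (d + 1)) (u : Site (d + 1)) (κ' : Fin (d + 1)) (u' p q : Site (d + 1)) (a b : Fib d) :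
    |S₂ κ u κ' u' p q a b| ≤ C₂ * Real.exp (-δ₂ * l1 (u' - p)) := by
  have hC₂ : 0 ≤ C₂ := hS₂.nonneg
  refine (hS₂ κ u κ' u' p q a b).trans ?_
  rw [mul_assoc, ← Real.exp_add]
  refine mul_le_mul_of_nonneg_left (Real.exp_le_exp.2 ?_) hC₂
  have t : l1 (u' - p) ≤ l1 (u' - u) + l1 (u - p) := l1_sub_triangle u' u p
  rw [l1_sub_symm u p] at t
  nlinarith [l1_nonneg (q - u)]

variable {n : ℕ} (hn : 0 < n) (r : Fin (d + 1) → ℕ)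
include hn

/-- [folklore] **THE TRANSPORTED SLICE `slotPsiS r n S₂ α x`, READ AT `(p, q)`, IS LOCALISED IN ITS SECOND BOND AT `p`**: every member `S₂ κ u` of the face sum obeys
`|S₂ κ u κ′ u′ p q a b| ≤ C₂·e^{−δ|u′−p|₁}` uniformly in `κ u` (`abs_slice_le_exp_left`), hence so does the transported slice, times `(1 + faceWtSum·(d+1)·2n^{d+1})`
(TT3b `abs_slotPsiS_le_of_bounded`). -/
theorem abs_slotPsiS_slice_le_exp_left (hS₂ : LocStencil₂ S₂ C₂ δ₂) (hδ₂ : 0 ≤ δ₂) (α : Fin (d + 1)) (x : Site (d + 1)) (κ' : Fin (d + 1)) (u' p q : Site (d + 1))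
    (a b : Fib d) :
    |slotPsiS r n S₂ α x κ' u' p q a b| ≤ C₂ * (1 + faceWtSum r n * (((d + 1 : ℕ) : ℝ) * (2 * (n : ℝ) ^ (d + 1)))) * Real.exp (-δ₂ * l1 (u' - p)) := by
  -- evaluate the module-valued transport at the slice entry `(κ', u', p, q, a, b)` and use the bounded-family lemma with the `u'`-dependent bound
  have e : slotPsiS r n S₂ α x κ' u' p q a b = slotPsiS r n (fun κ u => S₂ κ u κ' u' p q a b) α x := by
    simp only [slotPsiS, SymCorrectorFace.faceSum, Pi.add_apply, Pi.smul_apply, Finset.sum_apply, smul_eq_mul]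
  rw [e, mul_right_comm]
  exact abs_slotPsiS_le_of_bounded hn r (fun κ u => abs_slice_le_exp_left hS₂ hδ₂ κ u κ' u' p q a b) α x

omit hn in
/-- [folklore] **THE INNER VERTEX OF A SLICE, READ AT AN ENTRY, IS LOCALISED IN THE FIRST BOND AT THE ENTRY's LEFT SITE**: for a decaying `K` (rate `m`) and
`LocStencil₂ S₂ C₂ m`, `|vertexOfK K n (S₂ κ u) ν y′ x z a b| ≤ (d+1)·C·C₂·Zl(m∕2)·e^{−m|u−x|₁}` (`biLoc_vertexOfK_slice`, dropping the packing and second-leg decay). -/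
theorem abs_vertexOfK_slice_le_exp_left {K : MKer (d + 1) (Fib d)} {C m : ℝ} (hK : Decays K C m) (hm : 0 < m)
    {S₂ : Fin (d + 1) → Site (d + 1) → Fin (d + 1) → Site (d + 1) → MKer (d + 1) (Fib d)} {C₂ : ℝ} (hS₂ : LocStencil₂ S₂ C₂ m)
    (ν : Fin (d + 1)) (y' : Site (d + 1)) (κ : Fin (d + 1)) (u x z : Site (d + 1)) (a b : Fib d) :
    |vertexOfK K n (S₂ κ u) ν y' x z a b| ≤ ((d + 1 : ℕ) : ℝ) * (C * C₂ * Zl (d + 1) (m / 2)) * Real.exp (-m * l1 (u - x)) := by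
  have hC : 0 ≤ C := hK.nonneg (Sum.inl 0)
  have hC₂ : 0 ≤ C₂ := hS₂.nonneg
  have hZ : 0 ≤ Zl (d + 1) (m / 2) := Zl_nonneg (half_pos hm)
  have h := biLoc_vertexOfK_slice (N := n) hK hC hS₂ hm κ u ν y' x z a b
  refine h.trans ?_
  have e1 : Real.exp (-(m / 2) * l1 (u - (n : ℤ) • y')) ≤ 1 := by rw [Real.exp_le_one_iff]; nlinarith [l1_nonneg (u - (n : ℤ) • y')]
  have e2 : Real.exp (-m * (l1 (x - u) + l1 (z - u))) ≤ Real.exp (-m * l1 (u - x)) := by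
    rw [l1_sub_symm x u]; exact Real.exp_le_exp.2 (by nlinarith [l1_nonneg (z - u)])
  calc ((d + 1 : ℕ) : ℝ) * (C * C₂ * Zl (d + 1) (m / 2) * Real.exp (-(m / 2) * l1 (u - (n : ℤ) • y'))) * Real.exp (-m * (l1 (x - u) + l1 (z - u)))
      ≤ ((d + 1 : ℕ) : ℝ) * (C * C₂ * Zl (d + 1) (m / 2) * 1) * Real.exp (-m * l1 (u - x)) :=
        mul_le_mul (mul_le_mul_of_nonneg_left (mul_le_mul_of_nonneg_left e1 (by positivity)) (by positivity)) e2 (Real.exp_pos _).le (by positivity)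
    _ = _ := by ring

end Slices

/-! ## §3 The pair slot adjunction -/

section Pair

variable {n : ℕ} (hn : 0 < n) {r : Fin (d + 1) → ℕ} (hr : r ∈ box (d + 1) n)
include hn hr

/-- [folklore] **THE PAIR SLOT ADJUNCTION AT `Ψ̂_S`** ((W-pair) of the road's `J1-DEFECT-WORDS.md` v0.1 §3): for every spread `K`, every local fine bi-stencil family `S₂` (`0 < δ`)
and every in-block root offset, `vertex2OfK (Ψ̂_S ∘ K ∘ Ψ̂_Sᵀ) n S₂ μ y ν y′ = vertex2OfK K n (fun α x => slotPsiS r n (slotPsiS r n S₂ α x)) μ y ν y′` — BOTH bond slots of the pair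
family are transported by the face sums (outer `slotPsiS` on `S₂` as a family in its first bond, inner on each slice); the expansion terminates at two insertions. -/
theorem vertex2OfK_conj_psiKS {K : MKer (d + 1) (Fib d)} (hK : Spr K)
    {S₂ : Fin (d + 1) → Site (d + 1) → Fin (d + 1) → Site (d + 1) → MKer (d + 1) (Fib d)} {C₂ δ₂ : ℝ} (hS₂ : LocStencil₂ S₂ C₂ δ₂) (hδ₂ : 0 < δ₂)
    (μ : Fin (d + 1)) (y : Site (d + 1)) (ν : Fin (d + 1)) (y' : Site (d + 1)) :
    vertex2OfK (comp (comp (psiKS r n) K) (trK (psiKS r n))) n S₂ μ y ν y'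
      = vertex2OfK K n (fun α x => slotPsiS r n (slotPsiS r n S₂ α x)) μ y ν y' := by
  have hΨ : Spr (psiKS r n) := spr_psiKS hn hr
  have hK' : Spr (comp (comp (psiKS r n) K) (trK (psiKS r n))) := spr_comp (spr_comp hΨ hK) hΨ.trK
  have hK2 := hK
  obtain ⟨CK, δK, hδK, hKd⟩ := hK2
  obtain ⟨C', δ', hδ', hK'd⟩ := hK'
  -- a common rate for the slice localisation: `m := min δ' δ₂`
  set m : ℝ := min δ' δ₂ with hm
  have hm0 : 0 < m := lt_min hδ' hδ₂
  have hK'm : Decays (comp (comp (psiKS r n) K) (trK (psiKS r n))) |C'| m := decays_of_le hK'd (min_le_left _ _)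
  have hS₂m : LocStencil₂ S₂ C₂ m := fun κ u κ' u' => by
    have hC₂ : 0 ≤ C₂ := hS₂.nonneg
    intro p q a b
    refine (hS₂ κ u κ' u' p q a b).trans ?_
    have hle : m ≤ δ₂ := min_le_right _ _
    refine mul_le_mul (mul_le_mul_of_nonneg_left (Real.exp_le_exp.2 (by nlinarith [l1_nonneg (u' - u)])) hC₂) (Real.exp_le_exp.2 (by nlinarith [l1_nonneg (p - u), l1_nonneg (q - u)]))
      (Real.exp_pos _).le (by positivity)
  -- STEP 1 (outer slot at `K'`), STEP 2 (commutation), STEP 3 (inner slot), entrywise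
  funext x z a b
  show vertexOfK (comp (comp (psiKS r n) K) (trK (psiKS r n))) n (fun κ u => vertexOfK (comp (comp (psiKS r n) K) (trK (psiKS r n))) n (S₂ κ u) ν y') μ y x z a b
    = vertexOfK K n (fun κ u => vertexOfK K n (slotPsiS r n (slotPsiS r n S₂ κ u)) ν y') μ y x z a b
  -- STEP 1: the outer slot at `K′` (centre `x`: the inner vertices of the slices are localised there)
  rw [vertexOfK_conj_psiKS_apply hn hr hK (fun κ u => vertexOfK (comp (comp (psiKS r n) K) (trK (psiKS r n))) n (S₂ κ u) ν y') μ y x z a b hm0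
    (fun κ u => abs_vertexOfK_slice_le_exp_left hK'm hm0 hS₂m ν y' κ u x z a b)]
  -- STEP 2: the outer transport commutes with the inner vertex: the family is `α x ↦ vertexOfK K′ n (slotPsiS r n S₂ α x) ν y′`
  rw [slotPsiS_vertexOfK_comm hK'd hδ' r S₂ (fun κ u κ' u' p q a b => abs_slice_le hS₂ hδ₂.le κ u κ' u' p q a b) ν y']
  -- STEP 3: the inner slot, slice by slice (centre `p` at each inner entry)
  have eF : (fun α x' => vertexOfK (comp (comp (psiKS r n) K) (trK (psiKS r n))) n (slotPsiS r n S₂ α x') ν y')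
      = fun α x' => vertexOfK K n (slotPsiS r n (slotPsiS r n S₂ α x')) ν y' := by
    funext α x' p q a' b'
    exact vertexOfK_conj_psiKS_apply hn hr hK _ ν y' p q a' b' hδ₂
      (fun κ' u' => abs_slotPsiS_slice_le_exp_left hn r hS₂ hδ₂.le α x' κ' u' p q a' b')
  rw [eF]

end Pair


end

end Summit.QuantumFields.BalabanUV.Beta.SymCorrectorPair
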